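import Mathlib.Algebra.Homology.DerivedCategory.Ext.ExactSequences
import Mathlib.Algebra.Homology.DerivedCategory.Ext.Linear
import Mathlib.CategoryTheory.Abelian.Projective.Dimension
import Mathlib.Algebra.Category.ModuleCat.Ext.HasExt
import Literature.RingTheory.CohomologyAnnihilator.Basic
import HarnessLib

/-!
# Stable annihilation of `Ext`, dimension shifting and the splitting criterion

Topic: `Literature/RingTheory/CohomologyAnnihilator`.

Folklore homological algebra about the `R`-module structure on `Ext X Y n` (Mathlib's
`CategoryTheory.Abelian.Ext`, with `Ext.instModule`) in an `R`-linear abelian category `C` with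
`HasExt.{w} C` (e.g. `C = ModuleCat R`), as used by Iyengar–Takahashi [IyengarTakahashi2014, §2]
when manipulating cohomology annihilators:

* **(A) stable annihilation kills positive `Ext`** (`smul_ext_eq_zero_of_comp_eq_smul_id`): if the
  homothety `c • 𝟙 Y` factors as `Y —ι→ P —π→ Y` through a projective object `P`, then
  `c • Extⁱ(Y, N) = 0` for every `N` and every `i ≥ 1` (more generally through an object of
  projective dimension `< n`, for `i ≥ n`:
  `smul_ext_eq_zero_of_comp_eq_smul_id_of_hasProjectiveDimensionLT`). Indeed
  `c • e = mk₀ (c • 𝟙) ∘ e = mk₀ ι ∘ (mk₀ π ∘ e)` and `mk₀ π ∘ e ∈ Extⁱ(P, N) = 0`.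
* **(B) dimension shifting for annihilators, injective direction**
  (`smul_ext_eq_zero_of_shortExact_of_projective`): for a short exact `0 → X₁ → X₂ → X₃ → 0` with
  `X₂` projective and `i ≥ 1`, if `c` kills `Extⁱ⁺¹(X₃, N)` then `c` kills `Extⁱ(X₁, N)` — by the
  contravariant long exact sequence `Extⁱ(X₂, N) → Extⁱ(X₁, N) → Extⁱ⁺¹(X₃, N)` (Mathlib's
  `Ext.contravariant_sequence_exact₁`); `mul_smul_ext_eq_zero_of_shortExact` is the version with
  an arbitrary middle term (`d • Extⁱ(X₂, N) = 0` and `c • Extⁱ⁺¹(X₃, N) = 0` imply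
  `(d * c) • Extⁱ(X₁, N) = 0`), and `smul_ext_eq_zero_of_mem_cohomologyAnnihilatorOfDegree_succ`
  is the instance "`c ∈ caⁿ⁺¹(R)`, `0 → Y → P → X → 0` exact in `ModuleCat R` with `P` projective
  and `X` finitely generated ⟹ `c • Extⁿ(Y, N) = 0` for `N` finitely generated" (`n ≥ 1`).
* **(C) splitting criterion** (`exists_comp_eq_smul_id_of_smul_extClass_eq_zero`, with converse
  `smul_extClass_eq_zero_of_comp_eq_smul_id`, and the dual
  `exists_comp_eq_smul_id_X₃_of_smul_extClass_eq_zero`): if `c` kills the class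
  `hS.extClass ∈ Ext¹(X₃, X₁)` of a short exact sequence `S`, then `c • 𝟙 X₁` extends over
  `S.f : X₁ → X₂`, i.e. `S.f ≫ φ = c • 𝟙 X₁` for some `φ : X₂ → X₁` (and dually `c • 𝟙 X₃` lifts
  along `S.g`).
* **the combination** (`smul_ext_X₁_eq_zero_of_forall_smul_ext_one_eq_zero`,
  `smul_ext_X₁_eq_zero_of_smul_extClass_eq_zero`): if moreover `X₂` is projective and `c` kills
  `Ext¹(X₃, X₁)` (or just `hS.extClass`), then `c` kills `Extⁱ(X₁, N)` for ALL objects `N` and all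
  `i ≥ 1`; `smul_ext_X₃_eq_zero_of_smul_extClass_eq_zero` is the same for `X₃`
  ([IyengarTakahashi2014, Remark 2.13]). In `ModuleCat R`:
  `smul_ext_eq_zero_of_forall_finite_smul_ext_one_eq_zero` (test objects `N` finitely generated in
  the hypothesis, arbitrary in the conclusion).

## References

* S. B. Iyengar, R. Takahashi, *Annihilation of cohomology and strong generation of module
  categories*, IMRN 2016; arXiv:1404.1476 — §2 (Remark 2.3, Remark 2.13). [`IyengarTakahashi2014`]
-/

noncomputable section

open CategoryTheory CategoryTheory.Abelian CategoryTheory.Limits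

universe w t v u

namespace Literature.RingTheory.CohomologyAnnihilator

section Linear

variable {R : Type t} [Ring R] {C : Type u} [Category.{v} C] [Abelian C] [Linear R C]
  [HasExt.{w} C]

/-! ## (A) Stable annihilation kills positive `Ext` -/

/-- The scalar action on `Ext` is precomposition with the homothety of the source:
`c • e = mk₀ (c • 𝟙 Y) ∘ e` (companion to Mathlib's `Ext.smul_eq_comp_mk₀`, which postcomposes
with the homothety of the target). [folklore] -/
theorem smul_eq_mk₀_smul_id_comp {Y N : C} {i : ℕ} (c : R) (e : Ext Y N i) :
    c • e = (Ext.mk₀ (c • 𝟙 Y)).comp e (zero_add i) := by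
  rw [Ext.mk₀_smul, Ext.smul_comp, Ext.mk₀_id_comp]

/-- Precomposition with a morphism `Y ⟶ Y'` factoring through an object `P` of projective
dimension `< n` kills `Extⁱ(Y', N)` for `i ≥ n`. [folklore] -/
theorem mk₀_comp_eq_zero_of_hasProjectiveDimensionLT {Y P Y' N : C} (ι : Y ⟶ P) (π : P ⟶ Y')
    {n : ℕ} [HasProjectiveDimensionLT P n] {i : ℕ} (hi : n ≤ i) (e : Ext Y' N i) :
    (Ext.mk₀ (ι ≫ π)).comp e (zero_add i) = 0 := by
  rw [← Ext.mk₀_comp_mk₀_assoc,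
    ((Ext.mk₀ π).comp e (zero_add i)).eq_zero_of_hasProjectiveDimensionLT n hi, Ext.comp_zero]

/-- **Stable annihilation kills `Ext` (projective dimension form).** If the homothety `c • 𝟙 Y`
factors as `Y —ι→ P —π→ Y` through an object `P` of projective dimension `< n`, then
`c • Extⁱ(Y, N) = 0` for every object `N` and every `i ≥ n`. [folklore] -/
theorem smul_ext_eq_zero_of_comp_eq_smul_id_of_hasProjectiveDimensionLT {Y P : C} (ι : Y ⟶ P)
    (π : P ⟶ Y) {c : R} (h : ι ≫ π = c • 𝟙 Y) {n : ℕ} [HasProjectiveDimensionLT P n] {N : C}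
    {i : ℕ} (hi : n ≤ i) (e : Ext Y N i) : c • e = 0 := by
  rw [smul_eq_mk₀_smul_id_comp, ← h, mk₀_comp_eq_zero_of_hasProjectiveDimensionLT ι π hi e]

/-- **(A) Stable annihilation kills positive `Ext`.** If the homothety `c • 𝟙 Y` factors as
`Y —ι→ P —π→ Y` through a projective object `P` (i.e. `c • 𝟙 Y` is "stably zero"), then
`c • Extⁱ(Y, N) = 0` for every object `N` and every `i ≥ 1`:
`c • e = mk₀ (c • 𝟙) ∘ e = mk₀ ι ∘ (mk₀ π ∘ e)` with `mk₀ π ∘ e ∈ Extⁱ(P, N) = 0`. [folklore] -/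
theorem smul_ext_eq_zero_of_comp_eq_smul_id {Y P : C} [Projective P] (ι : Y ⟶ P) (π : P ⟶ Y)
    {c : R} (h : ι ≫ π = c • 𝟙 Y) {N : C} {i : ℕ} (hi : 1 ≤ i) (e : Ext Y N i) : c • e = 0 :=
  smul_ext_eq_zero_of_comp_eq_smul_id_of_hasProjectiveDimensionLT ι π h hi e

/-! ## (B) Dimension shifting for annihilators, injective direction -/

/-- **Dimension shifting for annihilators, general middle term.** Let `0 → X₁ → X₂ → X₃ → 0` be
short exact. If `d` kills `Extⁱ(X₂, N)` and `c` kills `Extⁱ⁺¹(X₃, N)`, then `d * c` kills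
`Extⁱ(X₁, N)`: in the exact `Extⁱ(X₂, N) → Extⁱ(X₁, N) —δ→ Extⁱ⁺¹(X₃, N)` one has
`δ (c • e) = c • δ e = 0`, so `c • e` comes from `Extⁱ(X₂, N)`, which `d` kills. [folklore] -/
theorem mul_smul_ext_eq_zero_of_shortExact {S : ShortComplex C} (hS : S.ShortExact) {N : C}
    {i : ℕ} {c d : R} (hd : ∀ e : Ext S.X₂ N i, d • e = 0)
    (hc : ∀ e : Ext S.X₃ N (i + 1), c • e = 0) (e : Ext S.X₁ N i) : (d * c) • e = 0 := by
  have hδ : hS.extClass.comp (c • e) (add_comm 1 i) = 0 := by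
    rw [Ext.comp_smul]
    exact hc _
  obtain ⟨y, hy⟩ := Ext.contravariant_sequence_exact₁ hS N (c • e) (add_comm 1 i) hδ
  rw [mul_smul, ← hy, ← Ext.comp_smul, hd y, Ext.comp_zero]

/-- **Dimension shifting for annihilators (projective dimension form).** Let
`0 → X₁ → X₂ → X₃ → 0` be short exact with `X₂` of projective dimension `< n`, and `i ≥ n`. If `c`
kills `Extⁱ⁺¹(X₃, N)` then `c` kills `Extⁱ(X₁, N)`. [folklore] -/
theorem smul_ext_eq_zero_of_shortExact_of_hasProjectiveDimensionLT {S : ShortComplex C}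
    (hS : S.ShortExact) {n : ℕ} [HasProjectiveDimensionLT S.X₂ n] {N : C} {i : ℕ} (hi : n ≤ i)
    {c : R} (hc : ∀ e : Ext S.X₃ N (i + 1), c • e = 0) (e : Ext S.X₁ N i) : c • e = 0 := by
  have h := mul_smul_ext_eq_zero_of_shortExact hS (d := 1)
    (fun y => by rw [y.eq_zero_of_hasProjectiveDimensionLT n hi, smul_zero]) hc e
  rwa [one_mul] at h

/-- **(B) Dimension shifting for annihilators, injective direction.** Let `0 → X₁ → X₂ → X₃ → 0`
be short exact with `X₂` projective and `i ≥ 1`. If `c` kills `Extⁱ⁺¹(X₃, N)` then `c` kills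
`Extⁱ(X₁, N)` (the connecting map `Extⁱ(X₁, N) → Extⁱ⁺¹(X₃, N)` is `R`-linear and injective).
[cite: IyengarTakahashi2014, Remark 2.3] -/
theorem smul_ext_eq_zero_of_shortExact_of_projective {S : ShortComplex C} (hS : S.ShortExact)
    [Projective S.X₂] {N : C} {i : ℕ} (hi : 1 ≤ i) {c : R}
    (hc : ∀ e : Ext S.X₃ N (i + 1), c • e = 0) (e : Ext S.X₁ N i) : c • e = 0 :=
  smul_ext_eq_zero_of_shortExact_of_hasProjectiveDimensionLT hS hi hc e

/-! ## (C) The splitting criterion -/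

/-- **(C) Splitting criterion.** Let `S : 0 → X₁ —f→ X₂ → X₃ → 0` be short exact with class
`hS.extClass ∈ Ext¹(X₃, X₁)`. If `c • hS.extClass = 0` then the homothety `c • 𝟙 X₁` extends over
`f`: there is `φ : X₂ ⟶ X₁` with `f ≫ φ = c • 𝟙 X₁` (for `c = 1`: the sequence splits). Proof: in
the exact `Hom(X₂, X₁) → Hom(X₁, X₁) —δ→ Ext¹(X₃, X₁)`,
`δ (c • 𝟙) = c • δ 𝟙 = c • hS.extClass = 0`. [folklore] -/
theorem exists_comp_eq_smul_id_of_smul_extClass_eq_zero {S : ShortComplex C} (hS : S.ShortExact)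
    {c : R} (h : c • hS.extClass = 0) : ∃ φ : S.X₂ ⟶ S.X₁, S.f ≫ φ = c • 𝟙 S.X₁ := by
  have hδ : hS.extClass.comp (Ext.mk₀ (c • 𝟙 S.X₁)) (add_zero 1) = 0 := by
    rw [Ext.mk₀_smul, Ext.comp_smul, Ext.comp_mk₀_id, h]
  obtain ⟨y, hy⟩ :=
    Ext.contravariant_sequence_exact₁ hS S.X₁ (Ext.mk₀ (c • 𝟙 S.X₁)) (add_zero 1) hδ
  obtain ⟨φ, rfl⟩ := (Ext.mk₀_bijective _ _).2 y
  refine ⟨φ, (Ext.mk₀_bijective _ _).1 ?_⟩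
  rw [← Ext.mk₀_comp_mk₀]
  exact hy

/-- **(C) Splitting criterion**, with the (stronger) hypothesis that `c` kills all of
`Ext¹(X₃, X₁)`. [folklore] -/
theorem exists_comp_eq_smul_id_of_forall_smul_ext_one_eq_zero {S : ShortComplex C}
    (hS : S.ShortExact) {c : R} (h : ∀ e : Ext S.X₃ S.X₁ 1, c • e = 0) :
    ∃ φ : S.X₂ ⟶ S.X₁, S.f ≫ φ = c • 𝟙 S.X₁ :=
  exists_comp_eq_smul_id_of_smul_extClass_eq_zero hS (h _)

/-- Converse of the splitting criterion: if `c • 𝟙 X₁` extends over `f` (`f ≫ φ = c • 𝟙 X₁`),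
then `c • hS.extClass = hS.extClass ∘ mk₀ (f ≫ φ) = (hS.extClass ∘ mk₀ f) ∘ mk₀ φ = 0`.
[folklore] -/
theorem smul_extClass_eq_zero_of_comp_eq_smul_id {S : ShortComplex C} (hS : S.ShortExact)
    {c : R} (φ : S.X₂ ⟶ S.X₁) (hφ : S.f ≫ φ = c • 𝟙 S.X₁) : c • hS.extClass = 0 := by
  rw [Ext.smul_eq_comp_mk₀, ← hφ, ← Ext.mk₀_comp_mk₀, ← Ext.comp_assoc_of_third_deg_zero,
    hS.extClass_comp, Ext.zero_comp]

/-- The splitting criterion as an equivalence: `c • hS.extClass = 0` iff `c • 𝟙 X₁` extends over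
`S.f`. [folklore] -/
theorem smul_extClass_eq_zero_iff {S : ShortComplex C} (hS : S.ShortExact) {c : R} :
    c • hS.extClass = 0 ↔ ∃ φ : S.X₂ ⟶ S.X₁, S.f ≫ φ = c • 𝟙 S.X₁ :=
  ⟨exists_comp_eq_smul_id_of_smul_extClass_eq_zero hS,
    fun ⟨φ, hφ⟩ => smul_extClass_eq_zero_of_comp_eq_smul_id hS φ hφ⟩

/-- **Splitting criterion, dual form.** If `c • hS.extClass = 0` then the homothety `c • 𝟙 X₃`
lifts along `g : X₂ → X₃`: there is `ψ : X₃ ⟶ X₂` with `ψ ≫ g = c • 𝟙 X₃` (exactness of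
`Hom(X₃, X₂) → Hom(X₃, X₃) —δ→ Ext¹(X₃, X₁)`, where `δ (c • 𝟙) = c • hS.extClass`).
[cite: IyengarTakahashi2014, Remark 2.13] -/
theorem exists_comp_eq_smul_id_X₃_of_smul_extClass_eq_zero {S : ShortComplex C}
    (hS : S.ShortExact) {c : R} (h : c • hS.extClass = 0) :
    ∃ ψ : S.X₃ ⟶ S.X₂, ψ ≫ S.g = c • 𝟙 S.X₃ := by
  have hδ : (Ext.mk₀ (c • 𝟙 S.X₃)).comp hS.extClass (zero_add 1) = 0 := by
    rw [Ext.mk₀_smul, Ext.smul_comp, Ext.mk₀_id_comp, h]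
  obtain ⟨y, hy⟩ :=
    Ext.covariant_sequence_exact₃ S.X₃ hS (Ext.mk₀ (c • 𝟙 S.X₃)) (zero_add 1) hδ
  obtain ⟨ψ, rfl⟩ := (Ext.mk₀_bijective _ _).2 y
  refine ⟨ψ, (Ext.mk₀_bijective _ _).1 ?_⟩
  rw [← Ext.mk₀_comp_mk₀]
  exact hy

/-! ## The combination: annihilating the extension class annihilates all positive `Ext` -/

/-- **Stable annihilation from the extension class (projective dimension form).** Let
`S : 0 → X₁ → X₂ → X₃ → 0` be short exact with `X₂` of projective dimension `< n`, and suppose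
`c • hS.extClass = 0`. Then `c • 𝟙 X₁` factors through `X₂` (splitting criterion), hence `c`
kills `Extⁱ(X₁, N)` for EVERY object `N` and every `i ≥ n`. [folklore] -/
theorem smul_ext_X₁_eq_zero_of_smul_extClass_eq_zero_of_hasProjectiveDimensionLT
    {S : ShortComplex C} (hS : S.ShortExact) {n : ℕ} [HasProjectiveDimensionLT S.X₂ n] {c : R}
    (h : c • hS.extClass = 0) {N : C} {i : ℕ} (hi : n ≤ i) (e : Ext S.X₁ N i) : c • e = 0 := by
  obtain ⟨φ, hφ⟩ := exists_comp_eq_smul_id_of_smul_extClass_eq_zero hS h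
  exact smul_ext_eq_zero_of_comp_eq_smul_id_of_hasProjectiveDimensionLT S.f φ hφ hi e

/-- **Stable annihilation from the extension class.** Let `S : 0 → X₁ → X₂ → X₃ → 0` be short
exact with `X₂` projective and suppose `c • hS.extClass = 0` (e.g. `c` kills `Ext¹(X₃, X₁)`).
Then `c • 𝟙 X₁` factors through the projective `X₂`, hence `c` kills `Extⁱ(X₁, N)` for EVERY
object `N` and every `i ≥ 1`. [folklore] -/
theorem smul_ext_X₁_eq_zero_of_smul_extClass_eq_zero {S : ShortComplex C} (hS : S.ShortExact)
    [Projective S.X₂] {c : R} (h : c • hS.extClass = 0) {N : C} {i : ℕ} (hi : 1 ≤ i)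
    (e : Ext S.X₁ N i) : c • e = 0 :=
  smul_ext_X₁_eq_zero_of_smul_extClass_eq_zero_of_hasProjectiveDimensionLT hS h hi e

/-- **Stable annihilation from `Ext¹(X₃, X₁)`.** Let `S : 0 → X₁ → X₂ → X₃ → 0` be short exact
with `X₂` projective. If `c` kills `Ext¹(X₃, X₁)`, then `c` kills `Extⁱ(X₁, N)` for EVERY object
`N` and every `i ≥ 1`. [folklore] -/
theorem smul_ext_X₁_eq_zero_of_forall_smul_ext_one_eq_zero {S : ShortComplex C}
    (hS : S.ShortExact) [Projective S.X₂] {c : R} (h : ∀ e : Ext S.X₃ S.X₁ 1, c • e = 0) {N : C}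
    {i : ℕ} (hi : 1 ≤ i) (e : Ext S.X₁ N i) : c • e = 0 :=
  smul_ext_X₁_eq_zero_of_smul_extClass_eq_zero hS (h _) hi e

/-- **Stable annihilation from the extension class, for `X₃`** (Remark 2.13): let
`S : 0 → X₁ → X₂ → X₃ → 0` be short exact with `X₂` projective and `c • hS.extClass = 0`. Then
`c • 𝟙 X₃` factors through the projective `X₂`, hence `c` kills `Extⁱ(X₃, N)` for EVERY object `N`
and every `i ≥ 1`. [cite: IyengarTakahashi2014, Remark 2.13] -/
theorem smul_ext_X₃_eq_zero_of_smul_extClass_eq_zero {S : ShortComplex C} (hS : S.ShortExact)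
    [Projective S.X₂] {c : R} (h : c • hS.extClass = 0) {N : C} {i : ℕ} (hi : 1 ≤ i)
    (e : Ext S.X₃ N i) : c • e = 0 := by
  obtain ⟨ψ, hψ⟩ := exists_comp_eq_smul_id_X₃_of_smul_extClass_eq_zero hS h
  exact smul_ext_eq_zero_of_comp_eq_smul_id ψ S.g hψ hi e

end Linear

/-! ## Instances in `ModuleCat R` in the language of `caⁿ(R)` -/

section ModuleCat

variable {R : Type u} [CommRing R]

/-- **One step of dimension shifting for `caⁿ⁺¹(R)`.** Let `c ∈ caⁿ⁺¹(R)` (so `c` kills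
`Ext^{≥ n+1}` between finitely generated modules), `n ≥ 1`, and let `S : 0 → Y → P → X → 0` be a
short exact sequence of `R`-modules with `P` projective and `X` finitely generated. Then `c` kills
`Extⁿ(Y, N)` for every finitely generated `N` (injective dimension shifting,
`smul_ext_eq_zero_of_shortExact_of_projective`; no hypothesis on `Y`, `P` or `R` beyond these).
[cite: IyengarTakahashi2014, Remark 2.3] -/
theorem smul_ext_eq_zero_of_mem_cohomologyAnnihilatorOfDegree_succ {n : ℕ} {c : R}
    (hc : c ∈ cohomologyAnnihilatorOfDegree R (n + 1)) (hn : 1 ≤ n)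
    {S : ShortComplex (ModuleCat.{u} R)} (hS : S.ShortExact) [Projective S.X₂]
    [Module.Finite R S.X₃] (N : ModuleCat.{u} R) [Module.Finite R N] (e : Ext.{u} S.X₁ N n) :
    c • e = 0 :=
  smul_ext_eq_zero_of_shortExact_of_projective hS hn
    (fun e' => smul_eq_zero_of_mem_cohomologyAnnihilatorOfDegree hc le_rfl e') e

/-- **One step of dimension shifting for `caⁿ⁺¹(R)`**, all degrees `i ≥ n` at once: with the
hypotheses of `smul_ext_eq_zero_of_mem_cohomologyAnnihilatorOfDegree_succ`, `c` kills `Extⁱ(Y, N)`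
for every finitely generated `N` and every `i ≥ n` (as `caⁿ⁺¹(R) ⊆ caⁱ⁺¹(R)`).
[cite: IyengarTakahashi2014, Remark 2.3] -/
theorem smul_ext_eq_zero_of_mem_cohomologyAnnihilatorOfDegree_succ_of_le {n : ℕ} {c : R}
    (hc : c ∈ cohomologyAnnihilatorOfDegree R (n + 1)) (hn : 1 ≤ n)
    {S : ShortComplex (ModuleCat.{u} R)} (hS : S.ShortExact) [Projective S.X₂]
    [Module.Finite R S.X₃] (N : ModuleCat.{u} R) [Module.Finite R N] {i : ℕ} (hi : n ≤ i)
    (e : Ext.{u} S.X₁ N i) : c • e = 0 :=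
  smul_ext_eq_zero_of_mem_cohomologyAnnihilatorOfDegree_succ
    (cohomologyAnnihilatorOfDegree_mono (Nat.succ_le_succ hi) hc) (hn.trans hi) hS N e

/-- **Stable annihilation in `ModuleCat R`, finitely generated test modules.** Let
`S : 0 → Y → P → X → 0` be short exact with `P` projective and `Y` finitely generated, and suppose
`c` kills `Ext¹(X, N)` for every FINITELY GENERATED `N` (e.g. after iterating
`smul_ext_eq_zero_of_mem_cohomologyAnnihilatorOfDegree_succ` down from `c ∈ caⁿ⁺¹(R)` along `n`
syzygy sequences). Then `c` kills `Ext¹(X, Y) ∋ hS.extClass`, so `c • 𝟙 Y` factors through `P`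
and `c` kills `Extⁱ(Y, N)` for EVERY `R`-module `N` and every `i ≥ 1`.
[cite: IyengarTakahashi2014, Remark 2.13] -/
theorem smul_ext_eq_zero_of_forall_finite_smul_ext_one_eq_zero {c : R}
    {S : ShortComplex (ModuleCat.{u} R)} (hS : S.ShortExact) [Projective S.X₂]
    [Module.Finite R S.X₁]
    (h : ∀ N : ModuleCat.{u} R, Module.Finite R N → ∀ e : Ext.{u} S.X₃ N 1, c • e = 0)
    (N : ModuleCat.{u} R) {i : ℕ} (hi : 1 ≤ i) (e : Ext.{u} S.X₁ N i) : c • e = 0 :=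
  smul_ext_X₁_eq_zero_of_forall_smul_ext_one_eq_zero hS (h S.X₁ ‹_›) hi e

/-- **Stable annihilation of second syzygies by `ca²(R)`.** Let `S : 0 → Y → P → X → 0` and
`S' : 0 → Y' → P' → Y'' → 0` be short exact in `ModuleCat R` with `P`, `P'` projective, `X` and
`Y'` finitely generated, together with an isomorphism `ε : Y'' ≅ Y` (two consecutive syzygy
sequences of `X`). If `c ∈ ca²(R)` then `c` kills `Ext¹(Y, N)` for finitely generated `N` (one
shift, `smul_ext_eq_zero_of_mem_cohomologyAnnihilatorOfDegree_succ`), hence `Ext¹(Y'', Y')`, hence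
`c • 𝟙 Y'` factors through `P'` and `c` kills `Extⁱ(Y', N)` for EVERY `R`-module `N` and every
`i ≥ 1` (`smul_ext_eq_zero_of_forall_finite_smul_ext_one_eq_zero`).
[cite: IyengarTakahashi2014, Remark 2.13] -/
theorem smul_ext_eq_zero_of_mem_cohomologyAnnihilatorOfDegree_two {c : R}
    (hc : c ∈ cohomologyAnnihilatorOfDegree R 2) {S : ShortComplex (ModuleCat.{u} R)}
    (hS : S.ShortExact) [Projective S.X₂] [Module.Finite R S.X₃]
    {S' : ShortComplex (ModuleCat.{u} R)} (hS' : S'.ShortExact) [Projective S'.X₂]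
    [Module.Finite R S'.X₁] (ε : S'.X₃ ≅ S.X₁) (N : ModuleCat.{u} R) {i : ℕ} (hi : 1 ≤ i)
    (e : Ext.{u} S'.X₁ N i) : c • e = 0 := by
  refine smul_ext_eq_zero_of_forall_finite_smul_ext_one_eq_zero hS' (fun N' hN' e' => ?_) N hi e
  -- transport along `ε`: `e' = mk₀ ε.hom ∘ (mk₀ ε.inv ∘ e')` with `mk₀ ε.inv ∘ e' ∈ Ext¹(S.X₁, N')`
  rw [← Ext.mk₀_id_comp e', ← ε.hom_inv_id, ← Ext.mk₀_comp_mk₀_assoc, ← Ext.comp_smul,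
    smul_ext_eq_zero_of_mem_cohomologyAnnihilatorOfDegree_succ hc le_rfl hS N' _, Ext.comp_zero]

end ModuleCat

end Literature.RingTheory.CohomologyAnnihilator
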